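import Mathlib.LinearAlgebra.FiniteDimensional.Lemmas
import Literature.Computability.AlgebraicComplexity.MatMulDirectSumCubicFormat
import HarnessLib

/-!
# The 111-equations: a concise tensor of minimal border rank is 111-abundant (Buczyńska–Buczyński 2021, Thm. 1.2; Jelisiejew–Landsberg–Pal 2023, §1)

Topic `Literature/Computability/AlgebraicComplexity`. For a tensor `t ∈ K^Z ⊗ K^X ⊗ K^Y` the
**111-space** `𝔞(t)` is the space of triples `(P,Q,R) ∈ End K^Z × End K^X × End K^Y` with
`P ·₁ t = Q ·₂ t = R ·₃ t` — the kernel of the tree's 111-map `lin111 t`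
(`MatMulDirectSumCubicFormat.lean`). For CONCISE `t` of cubic format `N × N × N` it is isomorphic to
Jelisiejew–Landsberg–Pal's "triple intersection" `(t(A*)⊗A) ∩ (t(B*)⊗B) ∩ (t(C*)⊗C)`, and the
statement "`bR(t) ≤ N ⟹ dim 𝔞(t) ≥ N`" (equivalently: the 111-map has rank `≤ 3N² - N`) is the
system of **111-equations** of Buczyńska–Buczyński (Duke Math. J. 170 (2021), Thm. 1.2, in the
language of the apolar ideal: at least `N - 1` minimal generators of degree `(1,1,1)`), as
reformulated in Jelisiejew–Landsberg–Pal, *Concise tensors of minimal border rank*, Math. Ann. 2023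
(arXiv:2205.05713), §1, p. 4 ("If `T` has border rank at most `m`, then the rank of the above map is
at most `3m² - m`. The resulting equations are called the 111-equations"; a concise `T` with
`dim ≥ m` is called *111-abundant*).

This file PROVES the statement for the border rank over `K[ε]` (`algBorderRank`, Bläser 2013,
Def. 6.1), over ANY field, for concise tensors whose three legs have the same cardinality `N`:

* `exists_linearIndependent_lin111_of_algBorderRank_le` — `bR(t) ≤ N` ⟹ there are `N` linearly
  independent elements of `𝔞(t)` (111-abundance);
* `lt_algBorderRank_of_lin111` / `lt_algBorderRank_of_finrank_ker_lin111_lt` — contrapositive: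
  if `dim 𝔞(t) < N` then `N < bR(t)` (the form used as a border-rank LOWER-BOUND certificate);
* `lt_algBorderRank_of_lt_finrank_range_lin111` — the same with the rank of the 111-map:
  `3N² - N < rank (lin111 t) ⟹ N < bR(t)`.

The proof is the one already carried out in `MatMulDirectSumCubicFormat.lean` for direct sums of
matrix tensors (Coppersmith–Winograd 1982, Rem. 6.2), whose first half is tensor-agnostic: an
order-`h` approximate decomposition with exactly `N` triads has nonsingular coefficient matrices
`U, V, W ∈ K[ε]^{N×N}` (conciseness of each leg, `det_ne_zero_of_isApproxDecomposition`); the exact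
triad tensor `T_ε = ε^h T̃`, `T̃(0) = t`, has the `N` independent 111-elements
`(dV dW·U Λ adj U, dU dW·V Λ adj V, dU dV·W Λ adj W)` (`linearIndependent_kappa_single`); and the
111-space is upper semicontinuous at `ε = 0` by the Smith normal form over the PID `K[ε]`
(`exists_linearIndependent_lin111_coeff_zero`). Nothing here is new mathematics; the file only
isolates the general criterion so that it can be cited and instantiated.

Motivation and HONEST FRAMING. The pub-tensor bundle (`papers/MatrixMultiplication/small-tensor-tables`,
VALUE.md §1/§3, `numerics/eq111.py`) applies exactly this criterion, by exact rational linear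
algebra, to 18 named cubic formats and to all 1622 classes of its support censuses (it lifts the
census lower bound to `m + 1` for the `4 × 4 × 4` class #88 and the `5 × 5 × 5` classes #1468, #1508,
#1514); with this theorem in the tree each such verdict becomes certifiable in the kernel by a rank
certificate for the (integer) matrix of `lin111`. This is barrier bookkeeping for the laser method on
toy tensors — certified tables / decidable verdicts / certificate, NOT summit progress on `ω`
(bundle framing: `P(ω ≤ 2.3 this quarter) < 1 %`).

## References

* W. Buczyńska, J. Buczyński, *Apolarity, border rank, and multigraded Hilbert scheme*, Duke Math.
  J. 170 (2021) 3659–3702, arXiv:1910.01944, Thm. 1.2 (= the second theorem of §1; held: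
  `paper:arxiv-1910.01944`, p. 4).
  [BuczynskaBuczynski2021]
* J. Jelisiejew, J. M. Landsberg, A. Pal, *Concise tensors of minimal border rank*, Math. Ann. (2023),
  arXiv:2205.05713, §1 (111-equations, 111-abundance, Prop. 1.1), p. 4 (held:
  `paper:arxiv-2205.05713`). [JelisiejewLandsbergPal2023]
* M. Bläser, *Fast Matrix Multiplication*, Theory of Computing Graduate Surveys 5 (2013), Def. 6.1.
  [Blaser2013]
-/

noncomputable section

open scoped BigOperators Polynomial Matrix
open Matrix Polynomial

namespace Literature.Computability.AlgebraicComplexity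

universe u

section OneOneOne

variable (K : Type u) [Field K]
variable {Z X Y : Type*} [Fintype Z] [Fintype X] [Fintype Y] [DecidableEq Z] [DecidableEq X]
  [DecidableEq Y] {N : ℕ}

/-- **111-abundance of concise tensors of minimal border rank** (Buczyńska–Buczyński 2021, Thm. 1.2;
Jelisiejew–Landsberg–Pal 2023, §1: the 111-equations), for the border rank over `K[ε]`, any field:
if `t ∈ K^Z ⊗ K^X ⊗ K^Y` is concise in each leg, `|Z| = |X| = |Y| = N` and `bR(t) ≤ N`, then the
111-space `𝔞(t) = ker (lin111 t)` contains `N` linearly independent triples.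
[cite: BuczynskaBuczynski2021, Thm. 1.2; JelisiejewLandsbergPal2023, §1 (p. 4)] -/
theorem exists_linearIndependent_lin111_of_algBorderRank_le (t : Z → X → Y → K)
    (hZ : LinearIndependent K fun z => t z) (hX : LinearIndependent K fun x => rotate t x)
    (hY : LinearIndependent K fun y => rotate (rotate t) y) (hcZ : Fintype.card Z = N)
    (hcX : Fintype.card X = N) (hcY : Fintype.card Y = N) (hR : algBorderRank t ≤ N) :
    ∃ g : Fin N → TripleIndex Z X Y → K, LinearIndependent K g ∧ ∀ i, lin111 t (g i) = 0 := by
  classical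
  -- an approximate decomposition with exactly `N` triads
  obtain ⟨h, hh⟩ := exists_algBorderRank_eq_approxRank t
  obtain ⟨u, v, w, hd⟩ := exists_isApproxDecomposition_of_approxRank_le (s := N) (hh ▸ hR)
  set eZ : Fin N ≃ Z := (Fintype.equivFinOfCardEq hcZ).symm
  set eX : Fin N ≃ X := (Fintype.equivFinOfCardEq hcX).symm
  set eY : Fin N ≃ Y := (Fintype.equivFinOfCardEq hcY).symm
  -- the coefficient matrices and their determinants
  set U : Matrix _ _ K[X] := Matrix.of fun z z' => u (eZ.symm z') z with hU
  set V : Matrix _ _ K[X] := Matrix.of fun x x' => v (eX.symm x') x with hV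
  set W : Matrix _ _ K[X] := Matrix.of fun y y' => w (eY.symm y') y with hW
  have hUd : U.det ≠ 0 := det_ne_zero_of_isApproxDecomposition hd hZ eZ
  have hVd : V.det ≠ 0 := det_ne_zero_of_isApproxDecomposition (isApproxDecomposition_rotate hd) hX eX
  have hWd : W.det ≠ 0 :=
    det_ne_zero_of_isApproxDecomposition (isApproxDecomposition_rotate (isApproxDecomposition_rotate hd))
      hY eY
  -- the exact triad tensor `T_ε = ε^h T̃` with `T̃(0) = t`
  set Tε := triadTensor U V W eZ eX eY with hTε
  have hTε_eq : ∀ z x y, Tε z x y = ∑ ρ, u ρ z * v ρ x * w ρ y := by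
    intro z x y
    simp [hTε, triadTensor, hU, hV, hW]
  set Tt : _ → _ → _ → K[X] := fun z x y => Tε z x y /ₘ (Polynomial.X ^ h) with hTt
  have hsplit : ∀ z x y, Tε z x y = Polynomial.X ^ h * Tt z x y := by
    intro z x y
    have hdvd : Polynomial.X ^ h ∣ Tε z x y := by
      rw [Polynomial.X_pow_dvd_iff]
      intro d hdh
      rw [hTε_eq, hd z x y d hdh.le, if_neg hdh.ne]
    have e := Polynomial.modByMonic_add_div (Tε z x y) (Polynomial.X ^ h)
    rw [(Polynomial.modByMonic_eq_zero_iff_dvd (Polynomial.monic_X_pow h)).2 hdvd, zero_add] at e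
    exact e.symm
  have hTt0 : (fun z x y => (Tt z x y).coeff 0) = t := by
    funext z x y
    have e := hd z x y h le_rfl
    rw [if_pos rfl, ← hTε_eq, hsplit] at e
    have e' := Polynomial.coeff_X_pow_mul (Tt z x y) h 0
    rw [zero_add] at e'
    rw [e'] at e
    exact e
  -- the `N` independent 111-elements of `T̃`
  have hker : ∀ c : Fin N → K[X], lin111 Tt (kappa U V W eZ eX eY c) = 0 := by
    intro c
    have e := lin111_triadTensor_kappa U V W eZ eX eY c
    have hfun : Tε = fun z x y => Polynomial.X ^ h * Tt z x y := by
      funext z x y; exact hsplit z x y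
    rw [← hTε, hfun, lin111_smul_tensor] at e
    exact (smul_eq_zero.1 e).resolve_left (pow_ne_zero h Polynomial.X_ne_zero)
  -- semicontinuity at `ε = 0`
  obtain ⟨g, hg, hgker⟩ := exists_linearIndependent_lin111_coeff_zero Tt
    (fun i => kappa U V W eZ eX eY (Pi.single i 1))
    (linearIndependent_kappa_single U V W eZ eX eY hUd hVd hWd) (fun i => hker _)
  rw [hTt0] at hgker
  exact ⟨g, hg, hgker⟩

/-- **The 111-equations as a border-rank lower bound** (contrapositive of
`exists_linearIndependent_lin111_of_algBorderRank_le`): if a concise `N × N × N` tensor has NO `N`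
linearly independent triples in its 111-space, then `N < bR(t)`, over any field.
[cite: JelisiejewLandsbergPal2023, §1 (p. 4)] -/
theorem lt_algBorderRank_of_lin111 (t : Z → X → Y → K)
    (hZ : LinearIndependent K fun z => t z) (hX : LinearIndependent K fun x => rotate t x)
    (hY : LinearIndependent K fun y => rotate (rotate t) y) (hcZ : Fintype.card Z = N)
    (hcX : Fintype.card X = N) (hcY : Fintype.card Y = N)
    (hsmall : ∀ g : Fin N → TripleIndex Z X Y → K, LinearIndependent K g → ∃ i, lin111 t (g i) ≠ 0) :
    N < algBorderRank t := by
  by_contra hle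
  rw [not_lt] at hle
  obtain ⟨g, hg, hker⟩ :=
    exists_linearIndependent_lin111_of_algBorderRank_le K t hZ hX hY hcZ hcX hcY hle
  obtain ⟨i, hi⟩ := hsmall g hg
  exact hi (hker i)

/-- **Not 111-abundant ⟹ not of minimal border rank**: if `dim_K 𝔞(t) = dim ker (lin111 t) < N`
for a concise `N × N × N` tensor `t`, then `N < bR(t)`, over any field.
[cite: JelisiejewLandsbergPal2023, §1 (p. 4)] -/
theorem lt_algBorderRank_of_finrank_ker_lin111_lt (t : Z → X → Y → K)
    (hZ : LinearIndependent K fun z => t z) (hX : LinearIndependent K fun x => rotate t x)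
    (hY : LinearIndependent K fun y => rotate (rotate t) y) (hcZ : Fintype.card Z = N)
    (hcX : Fintype.card X = N) (hcY : Fintype.card Y = N)
    (hdim : Module.finrank K (LinearMap.ker (lin111 t)) < N) : N < algBorderRank t := by
  refine lt_algBorderRank_of_lin111 K t hZ hX hY hcZ hcX hcY fun g hg => ?_
  by_contra hall
  simp only [not_exists, ne_eq, not_not] at hall
  have hg' : LinearIndependent K (fun i => (⟨g i, hall i⟩ : LinearMap.ker (lin111 t))) :=
    LinearIndependent.of_comp (LinearMap.ker (lin111 t)).subtype hg
  have hle := hg'.fintype_card_le_finrank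
  rw [Fintype.card_fin] at hle
  omega

/-- **The 111-equations in rank form** (Jelisiejew–Landsberg–Pal 2023, §1: "if `T` has border rank
at most `m`, then the rank of the [111-]map is at most `3m² - m`"), contrapositive, for concise
tensors over any field: `3N² - N < rank (lin111 t) ⟹ N < bR(t)`.
[cite: JelisiejewLandsbergPal2023, §1 (p. 4)] -/
theorem lt_algBorderRank_of_lt_finrank_range_lin111 (t : Z → X → Y → K)
    (hZ : LinearIndependent K fun z => t z) (hX : LinearIndependent K fun x => rotate t x)
    (hY : LinearIndependent K fun y => rotate (rotate t) y) (hcZ : Fintype.card Z = N)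
    (hcX : Fintype.card X = N) (hcY : Fintype.card Y = N)
    (hrk : 3 * N ^ 2 - N < Module.finrank K (LinearMap.range (lin111 t))) : N < algBorderRank t := by
  refine lt_algBorderRank_of_finrank_ker_lin111_lt K t hZ hX hY hcZ hcX hcY ?_
  have hrn := LinearMap.finrank_range_add_finrank_ker (lin111 t)
  have hdom : Module.finrank K (TripleIndex Z X Y → K) = N * N + (N * N + N * N) := by
    rw [Module.finrank_fintype_fun_eq_card, Fintype.card_sum, Fintype.card_sum, Fintype.card_prod,
      Fintype.card_prod, Fintype.card_prod, hcZ, hcX, hcY]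
  rw [hdom] at hrn
  have h2 : N ^ 2 = N * N := Nat.pow_two N
  rw [h2] at hrk
  omega

end OneOneOne

end Literature.Computability.AlgebraicComplexity

end
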